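import Summits.HodgeConjecture.HodgeConjecture.Theorems.R90S6TypeTwoCayleyBlock    -- ★ B1 (this seat): `exists_cayleyShift_literal`, `v_eq_of_mul_sq_eq`, `v_le_of_sq_le_sq`, `adjoin_one_add_eq`
import Literature.NumberTheory.Automorphic.UnitaryLatticeTreeCharpolyCongruence      -- ★ `v_inv_mul_charpoly_coeff_sub_le_one` (`A ≡ B mod c ⇒ χ_A ≡ χ_B mod c`), `IsIntMatrix`
import HarnessLib

/-!
# R90 · S6 — LINE G1 «geometric fixed subtree», RUNG 2 (B2): THE CAYLEY SHIFT OF A TYPE-(2) ELEMENT — `Y = φ_ϖ(u⁻¹γ) ∈ U`, same anisotropic eigenvector,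
# exponents `(n, N) ↦ (n−2, N−1)`, the shifted-order memberships of ★ ROW 0; and `χ_γ ≡ (X − u)³` (`Theorems/R90S6TypeTwoCayleyShift.lean`)

Cell `hodgecm-mathlib`, crux H413 (`stmt-HodgeConjecture-24833`), route of record `HCCMUnconditional`; programme R90-TF, section S6 (base `R90-C14`), seat R90-C14-p07 (g2,
heir of g0); S6 dealer R90-C14-plan (g2) RULING G1-R2 (2026-09-05T01:08:15Z) + re-deal 01:30:33Z: part (B) = heads (R2.c) `exists_cayleyShift_of_typeTwo` + (R2.d)
`norm_eq_one_and_charpoly_congr_of_typeTwo` VERBATIM from `R90/R90-C14-p07/g0/S6_G1_rung2_HEADS.v2.R90-C14-p07-g0.lean` bcae522735dd730a (= typ1 G1 sheet v1.4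
96937d52191e3a9e :342 ∕ :371).  FILE B2 of 2 (B1 = ★ `R90S6TypeTwoCayleyBlock`: the shift in the literal frame).  Helper lane `--supports stmt-HodgeConjecture-24833 --as helper`;
THEOREMS ONLY (no definition, no instance, no notation, no named fact, no `sorry`); imports = ★ B1 + ★ `UnitaryLatticeTreeCharpolyCongruence` + HarnessLib.

THE MATHEMATICS [Kottwitz1986BaseChangeUnits, §1 pp. 240–241; Rogawski1990, §4.9 Prop. 4.9.1 (b) p. 55; Flicker1998UnitaryFL, §6, Theorem 18 p. 97].  `K` non-dyadic valued,
complete with finite residue field (★ a₀'s frame binders), `U = U(σ, J₀)(K)`.  A TYPE-(2) element `γ ∈ U` — anisotropic eigenvector `x` (`γx = ux`, `|B₀(x,x)|` even) and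
exponents `|(tr γ − u)² − 4 det γ∕u| = |ϖ^{2N+1}|`, `|u² − (tr γ − u)u + det γ∕u| = |ϖ^n|` — is `U`-conjugate to its LITERAL FRAME `t = g⁻¹γg = (A 0 Cρ; 0 u 0; C 0 A)` (★
`exists_conj_coe_eq_ramifiedTorus`), where `|C| = |ϖ^N|` and `|(u − A)² − C²ρ| = |ϖ^n|` (★ `v_disc_and_v_eval_of_ramifiedTorus`).  (§1) (R2.c): ★ B1's literal shift `Y′`
of `t` (fixing `g⁻¹x`, exponents `(n−2, N−1)`, memberships at `X′ = 1 + ϖ⁻¹(u⁻¹t − 1)`) is transported to `Y = gY′g⁻¹`: `Yx = x`, `tr`, `det` are conjugation invariant, and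
`X = 1 + ϖ⁻¹(u⁻¹γ − 1) = gX′g⁻¹`, so the three memberships follow from `g·𝒪[W]·g⁻¹ ⊆ 𝒪[gWg⁻¹]` (`conj_mem_adjoin_conj`).  (§2) (R2.d): `σu·u = 1` and `|u| = 1` come with the
frame; for `2 ≤ n`, `1 ≤ N` one has `|A − u|, |C|, |Cρ| ≤ |ϖ|`, i.e. `t ≡ u·1 (mod ϖ)` entrywise, hence `χ_γ = χ_t ≡ χ_{u·1} = (X − u)³ (mod ϖ)` coefficientwise (★
`v_inv_mul_charpoly_coeff_sub_le_one`, Mathlib `charpoly_units_conj'`, `charpoly_diagonal`).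
HONEST LABEL: an assembly over ★ B1, ★ (d3) and the ★ charpoly-congruence token, in S6's abstract letters; count-neutral; consumed by part (C) (`R90S6TorusFixedSpecialCountClosedForm`).
HC_CM is proved only modulo the 7 printed citations (2 remaining named inputs: hLiu418 = stmt-HodgeConjecture-24832, h413 = stmt-HodgeConjecture-24833) until rung 0 closes.

## References
* [Kottwitz1986BaseChangeUnits] R. E. Kottwitz, *Base change for unit elements of Hecke algebras*, Compositio Math. 60 (1986) 237–250, §1 pp. 240–241.
* [Rogawski1990] J. D. Rogawski, *Automorphic Representations of Unitary Groups in Three Variables*, Ann. of Math. Stud. 123 (1990), §4.9 Prop. 4.9.1 (b) p. 55.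
* [Flicker1998UnitaryFL] Y. Z. Flicker, *Elementary proof of the fundamental lemma for a unitary group*, Canad. J. Math. 50 (1998), §6; Theorem 18 p. 97.
* [Lang2002] S. Lang, *Algebra*, 3rd ed. (2002), Ch. XIV §3 p. 561 (characteristic polynomial under reduction).
-/
set_option autoImplicit false
-- the mandated namespace repeats the single-problem summit's segment (`HodgeConjecture.HodgeConjecture`)
set_option linter.dupNamespace false

noncomputable section

open Matrix Polynomial
open Literature.NumberTheory.Automorphic Literature.NumberTheory.Automorphic.HermitianLattice Literature.NumberTheory.Automorphic.UnitaryGroup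
open Literature.NumberTheory.Automorphic.MoebiusShift Literature.NumberTheory.Automorphic.UnitaryLatticeTree
open scoped Matrix MatrixGroups WithZero ValuativeRel

namespace Summit.HodgeConjecture.HodgeConjecture.R90.S6

/-! ### §0 Conjugation transport of the shifted order -/

section Transport

variable {K : Type*} [Field K] (O : Subring K)

/-- Conjugation `B ↦ PBP⁻¹` (`det P` a unit) maps the order `𝒪[W]` into `𝒪[PWP⁻¹]`. [cite: Kottwitz1986BaseChangeUnits, §1 pp. 240–241] -/
theorem conj_mem_adjoin_conj {m : Type*} [Fintype m] [DecidableEq m] {P : Matrix m m K} (hP : IsUnit P.det) {W B : Matrix m m K}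
    (hB : B ∈ Algebra.adjoin O ({W} : Set (Matrix m m K))) :
    P * B * P⁻¹ ∈ Algebra.adjoin O ({P * W * P⁻¹} : Set (Matrix m m K)) := by
  have hPP : P⁻¹ * P = 1 := Matrix.nonsing_inv_mul P hP
  set T : Subalgebra O (Matrix m m K) := Algebra.adjoin O ({P * W * P⁻¹} : Set (Matrix m m K)) with hT
  let S : Subalgebra O (Matrix m m K) :=
    { carrier := {B | P * B * P⁻¹ ∈ T}
      mul_mem' := by
        intro A B (hA : P * A * P⁻¹ ∈ T) (hB : P * B * P⁻¹ ∈ T)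
        have e : P * (A * B) * P⁻¹ = (P * A * P⁻¹) * (P * B * P⁻¹) := by
          calc P * (A * B) * P⁻¹ = P * A * (P⁻¹ * P) * B * P⁻¹ := by rw [hPP, Matrix.mul_one]; simp only [Matrix.mul_assoc]
            _ = (P * A * P⁻¹) * (P * B * P⁻¹) := by simp only [Matrix.mul_assoc]
        show P * (A * B) * P⁻¹ ∈ T
        rw [e]; exact Subalgebra.mul_mem _ hA hB
      one_mem' := by show P * 1 * P⁻¹ ∈ T; rw [Matrix.mul_one, Matrix.mul_nonsing_inv P hP]; exact Subalgebra.one_mem _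
      add_mem' := by
        intro A B (hA : P * A * P⁻¹ ∈ T) (hB : P * B * P⁻¹ ∈ T)
        show P * (A + B) * P⁻¹ ∈ T
        rw [Matrix.mul_add, Matrix.add_mul]; exact Subalgebra.add_mem _ hA hB
      zero_mem' := by show P * 0 * P⁻¹ ∈ T; rw [Matrix.mul_zero, Matrix.zero_mul]; exact Subalgebra.zero_mem _
      algebraMap_mem' := by
        intro a
        show P * algebraMap O (Matrix m m K) a * P⁻¹ ∈ T
        rw [Algebra.algebraMap_eq_smul_one, Matrix.mul_smul, Matrix.smul_mul, Matrix.mul_one, Matrix.mul_nonsing_inv P hP, ← Algebra.algebraMap_eq_smul_one]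
        exact Subalgebra.algebraMap_mem _ a }
  have hW : W ∈ S := by
    show P * W * P⁻¹ ∈ T
    exact Algebra.self_mem_adjoin_singleton O _
  exact (Algebra.adjoin_le (Set.singleton_subset_iff.2 hW) : Algebra.adjoin O _ ≤ S) hB

omit O in
/-- Conjugation of the shifted coordinate: `P(1 + a(bM − 1))P⁻¹ = 1 + a(b·PMP⁻¹ − 1)`. [cite: Kottwitz1986BaseChangeUnits, §1 pp. 240–241] -/
theorem conj_one_add_smul_sub_one {m : Type*} [Fintype m] [DecidableEq m] {P : Matrix m m K} (hP : IsUnit P.det) (M : Matrix m m K) (a b : K) :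
    P * (1 + a • (b • M - 1)) * P⁻¹ = 1 + a • (b • (P * M * P⁻¹) - 1) := by
  have e1 : (1 : Matrix m m K) + a • (b • M - 1) = (1 - a) • (1 : Matrix m m K) + (a * b) • M := by module
  have e2 : (1 : Matrix m m K) + a • (b • (P * M * P⁻¹) - 1) = (1 - a) • (1 : Matrix m m K) + (a * b) • (P * M * P⁻¹) := by module
  rw [e1, e2, Matrix.mul_add, Matrix.add_mul, Matrix.mul_smul, Matrix.smul_mul, Matrix.mul_one, Matrix.mul_nonsing_inv P hP, Matrix.mul_smul, Matrix.smul_mul]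

end Transport

/-! ### §1 (R2.c) The Cayley shift of a type-(2) element -/

section Shift

variable {K : Type*} [Field K] [Valued K ℤᵐ⁰]

set_option maxHeartbeats 800000 in
-- the frame term of ★ `exists_conj_coe_eq_ramifiedTorus` and six transported conjuncts in one proof
/-- **G1 RUNG 2 (R2.c) — THE CAYLEY SHIFT OF A TYPE-(2) ELEMENT.**  For a type-(2) `γ ∈ U(σ, J₀)(K)` (anisotropic eigenvector `x`, `γx = ux`, `|B₀(x,x)|` even; exponents
`|(tr γ − u)² − 4 det γ∕u| = |ϖ^{2N+1}|`, `|u² − (tr γ − u)u + det γ∕u| = |ϖ^n|`, `2 ≤ n`, `1 ≤ N`) there is `Y ∈ U` — the Cayley∕Möbius shift `φ_ϖ(u⁻¹γ)`, built in the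
literal frame (★ B1 `exists_cayleyShift_literal`) and conjugated back — with `Yx = x`, exponents `(n−2, N−1)` in ★ a₀'s spelling (at eigenvalue `1`), and the three
shifted-order memberships of ★ ROW 0: `Y, Y⁻¹ ∈ 𝒪[X]`, `X ∈ 𝒪[Y]`, `X = 1 + ϖ⁻¹(u⁻¹γ − 1)`.
[cite: Kottwitz1986BaseChangeUnits, §1 pp. 240–241] [cite: Rogawski1990, §4.9 Prop. 4.9.1 (b) p. 55] [cite: Flicker1998UnitaryFL, §6; Theorem 18 p. 97] -/
theorem exists_cayleyShift_of_typeTwo [ValuativeRel K] [(Valued.v : Valuation K ℤᵐ⁰).Compatible]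
    [IsDiscreteValuationRing (Valued.integer K)] [Finite (IsLocalRing.ResidueField (Valued.integer K))]
    [IsAdicComplete (IsLocalRing.maximalIdeal (Valued.integer K)) (Valued.integer K)]
    {σ : K →+* K} {ϖ : K} (hd : LocalConjDatum σ ϖ)
    (hσO : ∀ y : Valued.integer K, (σ.comp (Valued.integer K).subtype) y ∈ Valued.integer K)
    {a₀ : Valued.integer K} (ha₀ : IsUnit (((σ.comp (Valued.integer K).subtype).codRestrict (Valued.integer K) hσO) a₀ - a₀))
    {γ : ↥(unitaryGroupOfForm σ ((StdForm.antidiagonal 3).over K))} {x : Fin 3 → K} {u : K}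
    (hγx : (((γ : ↥(unitaryGroupOfForm σ ((StdForm.antidiagonal 3).over K))) : GL (Fin 3) K) : Matrix (Fin 3) (Fin 3) K) *ᵥ x = u • x)
    {k : ℤ} (hx : Valued.v (B₀ σ 3 x x) = WithZero.exp (2 * k))
    {N n : ℕ} (hN : Valued.v ((Matrix.trace (((γ : ↥(unitaryGroupOfForm σ ((StdForm.antidiagonal 3).over K))) : GL (Fin 3) K) : Matrix (Fin 3) (Fin 3) K) - u) ^ 2 -
      4 * (Matrix.det (((γ : ↥(unitaryGroupOfForm σ ((StdForm.antidiagonal 3).over K))) : GL (Fin 3) K) : Matrix (Fin 3) (Fin 3) K) / u)) = Valued.v (ϖ ^ (2 * N + 1)))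
    (hn : Valued.v (u ^ 2 - (Matrix.trace (((γ : ↥(unitaryGroupOfForm σ ((StdForm.antidiagonal 3).over K))) : GL (Fin 3) K) : Matrix (Fin 3) (Fin 3) K) - u) * u +
      Matrix.det (((γ : ↥(unitaryGroupOfForm σ ((StdForm.antidiagonal 3).over K))) : GL (Fin 3) K) : Matrix (Fin 3) (Fin 3) K) / u) = Valued.v (ϖ ^ n))
    (hn2 : 2 ≤ n) (hN1 : 1 ≤ N) :
    ∃ Y : ↥(unitaryGroupOfForm σ ((StdForm.antidiagonal 3).over K)),
      ((Y : GL (Fin 3) K) : Matrix (Fin 3) (Fin 3) K) *ᵥ x = (1 : K) • x ∧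
      Valued.v ((Matrix.trace ((Y : GL (Fin 3) K) : Matrix (Fin 3) (Fin 3) K) - 1) ^ 2 - 4 * (Matrix.det ((Y : GL (Fin 3) K) : Matrix (Fin 3) (Fin 3) K) / 1)) =
        Valued.v (ϖ ^ (2 * (N - 1) + 1)) ∧
      Valued.v ((1 : K) ^ 2 - (Matrix.trace ((Y : GL (Fin 3) K) : Matrix (Fin 3) (Fin 3) K) - 1) * 1 + Matrix.det ((Y : GL (Fin 3) K) : Matrix (Fin 3) (Fin 3) K) / 1) =
        Valued.v (ϖ ^ (n - 2)) ∧
      ((Y : GL (Fin 3) K) : Matrix (Fin 3) (Fin 3) K) ∈ Algebra.adjoin (ValuativeRel.valuation K).integer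
        ({1 + ϖ⁻¹ • (u⁻¹ • ((γ : GL (Fin 3) K) : Matrix (Fin 3) (Fin 3) K) - 1)} : Set (Matrix (Fin 3) (Fin 3) K)) ∧
      ((((Y : GL (Fin 3) K))⁻¹ : GL (Fin 3) K) : Matrix (Fin 3) (Fin 3) K) ∈ Algebra.adjoin (ValuativeRel.valuation K).integer
        ({1 + ϖ⁻¹ • (u⁻¹ • ((γ : GL (Fin 3) K) : Matrix (Fin 3) (Fin 3) K) - 1)} : Set (Matrix (Fin 3) (Fin 3) K)) ∧
      (1 + ϖ⁻¹ • (u⁻¹ • ((γ : GL (Fin 3) K) : Matrix (Fin 3) (Fin 3) K) - 1)) ∈ Algebra.adjoin (ValuativeRel.valuation K).integer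
        ({((Y : GL (Fin 3) K) : Matrix (Fin 3) (Fin 3) K)} : Set (Matrix (Fin 3) (Fin 3) K)) := by
  have hvpow : ∀ j : ℕ, Valued.v (ϖ ^ j) = WithZero.exp (-(j : ℤ)) := fun j => by
    rw [map_pow, hd.vϖ, ← WithZero.exp_nsmul, nsmul_eq_mul, mul_neg, mul_one]
  have hmat : ∀ a b : ↥(unitaryGroupOfForm σ ((StdForm.antidiagonal 3).over K)), (((a * b : ↥(unitaryGroupOfForm σ ((StdForm.antidiagonal 3).over K))) : GL (Fin 3) K) :
      Matrix (Fin 3) (Fin 3) K) = ((a : GL (Fin 3) K) : Matrix (Fin 3) (Fin 3) K) * ((b : GL (Fin 3) K) : Matrix (Fin 3) (Fin 3) K) := fun a b => by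
    rw [Subgroup.coe_mul, Units.val_mul]
  -- (d3) the literal frame
  obtain ⟨m, hm⟩ : ∃ m : ℤ, Valued.v ((Matrix.trace (((γ : ↥(unitaryGroupOfForm σ ((StdForm.antidiagonal 3).over K))) : GL (Fin 3) K) : Matrix (Fin 3) (Fin 3) K) - u) ^ 2 -
      4 * (Matrix.det (((γ : ↥(unitaryGroupOfForm σ ((StdForm.antidiagonal 3).over K))) : GL (Fin 3) K) : Matrix (Fin 3) (Fin 3) K) / u)) = WithZero.exp (2 * m + 1) :=
    ⟨-(N : ℤ) - 1, by rw [hN, hvpow]; congr 1; push_cast; ring⟩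
  obtain ⟨g, A, C, ρ, hlit, hC0, hvρ, -, hσu, htr, hdet⟩ := exists_conj_coe_eq_ramifiedTorus σ rfl hd hσO ha₀ hγx hx hm
  have hu0 : u ≠ 0 := fun h0 => by rw [h0, mul_zero] at hσu; exact zero_ne_one hσu
  -- the exponents in the frame
  obtain ⟨hvdisc, -⟩ := v_disc_and_v_eval_of_ramifiedTorus σ hd hu0 hvρ htr hdet
  have hvC : Valued.v C = Valued.v (ϖ ^ N) := v_eq_of_mul_sq_eq hd.vϖ ((Valuation.ne_zero_iff _).2 hC0) (by rw [← hvdisc, hN])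
  have hχ : Valued.v ((u - A) ^ 2 - C ^ 2 * ρ) = Valued.v (ϖ ^ n) := by
    have e : u ^ 2 - (Matrix.trace (((γ : ↥(unitaryGroupOfForm σ ((StdForm.antidiagonal 3).over K))) : GL (Fin 3) K) : Matrix (Fin 3) (Fin 3) K) - u) * u +
        Matrix.det (((γ : ↥(unitaryGroupOfForm σ ((StdForm.antidiagonal 3).over K))) : GL (Fin 3) K) : Matrix (Fin 3) (Fin 3) K) / u = (u - A) ^ 2 - C ^ 2 * ρ := by
      rw [htr, hdet]; field_simp; ring
    rw [← e]; exact hn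
  -- the frame matrices `P = g`, `P⁻¹ = g⁻¹`
  set P : Matrix (Fin 3) (Fin 3) K := ((g : GL (Fin 3) K) : Matrix (Fin 3) (Fin 3) K) with hP
  have hPu : IsUnit P.det := (Matrix.isUnit_iff_isUnit_det P).1 (Units.isUnit (g : GL (Fin 3) K))
  have hPinv : (((g⁻¹ : ↥(unitaryGroupOfForm σ ((StdForm.antidiagonal 3).over K))) : GL (Fin 3) K) : Matrix (Fin 3) (Fin 3) K) = P⁻¹ := by
    rw [Subgroup.coe_inv, Matrix.coe_units_inv]
  set t : ↥(unitaryGroupOfForm σ ((StdForm.antidiagonal 3).over K)) := g⁻¹ * γ * g with ht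
  have htP : ((t : GL (Fin 3) K) : Matrix (Fin 3) (Fin 3) K) = P⁻¹ * (((γ : ↥(unitaryGroupOfForm σ ((StdForm.antidiagonal 3).over K))) : GL (Fin 3) K) : Matrix (Fin 3) (Fin 3) K) * P := by
    rw [ht, hmat, hmat, hPinv]
  have hγP : (((γ : ↥(unitaryGroupOfForm σ ((StdForm.antidiagonal 3).over K))) : GL (Fin 3) K) : Matrix (Fin 3) (Fin 3) K) = P * ((t : GL (Fin 3) K) : Matrix (Fin 3) (Fin 3) K) * P⁻¹ := by
    rw [htP]
    calc (((γ : ↥(unitaryGroupOfForm σ ((StdForm.antidiagonal 3).over K))) : GL (Fin 3) K) : Matrix (Fin 3) (Fin 3) K)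
        = (P * P⁻¹) * (((γ : ↥(unitaryGroupOfForm σ ((StdForm.antidiagonal 3).over K))) : GL (Fin 3) K) : Matrix (Fin 3) (Fin 3) K) * (P * P⁻¹) := by
          rw [Matrix.mul_nonsing_inv P hPu, Matrix.one_mul, Matrix.mul_one]
      _ = P * (P⁻¹ * (((γ : ↥(unitaryGroupOfForm σ ((StdForm.antidiagonal 3).over K))) : GL (Fin 3) K) : Matrix (Fin 3) (Fin 3) K) * P) * P⁻¹ := by
          simp only [Matrix.mul_assoc]
  -- the eigenvector in the frame: `t (g⁻¹x) = u (g⁻¹x)`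
  have htx : ((t : GL (Fin 3) K) : Matrix (Fin 3) (Fin 3) K) *ᵥ (P⁻¹ *ᵥ x) = u • (P⁻¹ *ᵥ x) := by
    rw [htP, Matrix.mulVec_mulVec, Matrix.mul_assoc, Matrix.mul_nonsing_inv P hPu, Matrix.mul_one, ← Matrix.mulVec_mulVec, hγx, Matrix.mulVec_smul]
  -- ★ B1: the shift in the literal frame
  obtain ⟨Y', h1, h2, h3, h4, h5, h6⟩ := exists_cayleyShift_literal hd hlit hvρ hvC hχ hn2 hN1 htx
  -- transport back along `g`
  have hYM : (((g * Y' * g⁻¹ : ↥(unitaryGroupOfForm σ ((StdForm.antidiagonal 3).over K))) : GL (Fin 3) K) : Matrix (Fin 3) (Fin 3) K) =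
      P * ((Y' : GL (Fin 3) K) : Matrix (Fin 3) (Fin 3) K) * P⁻¹ := by rw [hmat, hmat, hPinv]
  have hYinv : (((((g * Y' * g⁻¹ : ↥(unitaryGroupOfForm σ ((StdForm.antidiagonal 3).over K))) : GL (Fin 3) K))⁻¹ : GL (Fin 3) K) : Matrix (Fin 3) (Fin 3) K) =
      P * ((((Y' : GL (Fin 3) K))⁻¹ : GL (Fin 3) K) : Matrix (Fin 3) (Fin 3) K) * P⁻¹ := by
    rw [← Subgroup.coe_inv, _root_.mul_inv_rev, _root_.mul_inv_rev, inv_inv, ← mul_assoc, hmat, hmat, Subgroup.coe_inv, hPinv]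
  have hX : (1 : Matrix (Fin 3) (Fin 3) K) + ϖ⁻¹ • (u⁻¹ • (((γ : ↥(unitaryGroupOfForm σ ((StdForm.antidiagonal 3).over K))) : GL (Fin 3) K) : Matrix (Fin 3) (Fin 3) K) - 1) =
      P * (1 + ϖ⁻¹ • (u⁻¹ • ((t : GL (Fin 3) K) : Matrix (Fin 3) (Fin 3) K) - 1)) * P⁻¹ := by
    rw [conj_one_add_smul_sub_one hPu, ← hγP]
  have htrY : Matrix.trace (P * ((Y' : GL (Fin 3) K) : Matrix (Fin 3) (Fin 3) K) * P⁻¹) = Matrix.trace ((Y' : GL (Fin 3) K) : Matrix (Fin 3) (Fin 3) K) := by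
    rw [Matrix.trace_mul_cycle, Matrix.nonsing_inv_mul P hPu, Matrix.one_mul]
  have hdetY : Matrix.det (P * ((Y' : GL (Fin 3) K) : Matrix (Fin 3) (Fin 3) K) * P⁻¹) = Matrix.det ((Y' : GL (Fin 3) K) : Matrix (Fin 3) (Fin 3) K) :=
    Matrix.det_conj ((Matrix.isUnit_iff_isUnit_det P).2 hPu) _
  refine ⟨g * Y' * g⁻¹, ?_, ?_, ?_, ?_, ?_, ?_⟩
  · rw [hYM, ← Matrix.mulVec_mulVec, ← Matrix.mulVec_mulVec, h1, one_smul, Matrix.mulVec_mulVec, Matrix.mul_nonsing_inv P hPu, Matrix.one_mulVec, one_smul]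
  · rw [hYM, htrY, hdetY]; exact h2
  · rw [hYM, htrY, hdetY]; exact h3
  · rw [hYM, hX]; exact conj_mem_adjoin_conj _ hPu h4
  · rw [hYinv, hX]; exact conj_mem_adjoin_conj _ hPu h5
  · rw [hX, hYM]; exact conj_mem_adjoin_conj _ hPu h6

/-! ### §2 (R2.d) The normalising scalar is the anisotropic eigenvalue; `χ_γ ≡ (X − u)³ (mod 𝔪)` -/

set_option maxHeartbeats 800000 in
-- the frame term of ★ `exists_conj_coe_eq_ramifiedTorus` and nine entry estimates in one proof
/-- **G1 RUNG 2 (R2.d).**  For a type-(2) `γ ∈ U(σ, J₀)(K)` with anisotropic eigenvalue `u` and exponents `(n, N)`, `2 ≤ n`, `1 ≤ N` (letters of (R2.c)): the normalising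
scalar IS the eigenvalue — `σu·u = 1` exactly, `|u| = 1` — and `χ_γ ≡ (X − u)³ (mod 𝔪)` coefficientwise (in the literal frame `t ≡ u·1 (mod ϖ)` entrywise, since
`|A − u|, |C|, |Cρ| ≤ |ϖ|`; ★ `v_inv_mul_charpoly_coeff_sub_le_one`, `χ_γ = χ_t`, `χ_{u·1} = (X − u)³`) — the `hχ` of rung 1 at `c := u`.
[cite: Flicker1998UnitaryFL, Theorem 18 p. 97] [cite: Rogawski1990, §4.9 Prop. 4.9.1 (b) p. 55] [cite: Lang2002, Ch. XIV §3 p. 561] -/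
theorem norm_eq_one_and_charpoly_congr_of_typeTwo
    [IsDiscreteValuationRing (Valued.integer K)] [Finite (IsLocalRing.ResidueField (Valued.integer K))]
    [IsAdicComplete (IsLocalRing.maximalIdeal (Valued.integer K)) (Valued.integer K)]
    {σ : K →+* K} {ϖ : K} (hd : LocalConjDatum σ ϖ)
    (hσO : ∀ y : Valued.integer K, (σ.comp (Valued.integer K).subtype) y ∈ Valued.integer K)
    {a₀ : Valued.integer K} (ha₀ : IsUnit (((σ.comp (Valued.integer K).subtype).codRestrict (Valued.integer K) hσO) a₀ - a₀))
    {γ : ↥(unitaryGroupOfForm σ ((StdForm.antidiagonal 3).over K))} {x : Fin 3 → K} {u : K}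
    (hγx : (((γ : ↥(unitaryGroupOfForm σ ((StdForm.antidiagonal 3).over K))) : GL (Fin 3) K) : Matrix (Fin 3) (Fin 3) K) *ᵥ x = u • x)
    {k : ℤ} (hx : Valued.v (B₀ σ 3 x x) = WithZero.exp (2 * k))
    {N n : ℕ} (hN : Valued.v ((Matrix.trace (((γ : ↥(unitaryGroupOfForm σ ((StdForm.antidiagonal 3).over K))) : GL (Fin 3) K) : Matrix (Fin 3) (Fin 3) K) - u) ^ 2 -
      4 * (Matrix.det (((γ : ↥(unitaryGroupOfForm σ ((StdForm.antidiagonal 3).over K))) : GL (Fin 3) K) : Matrix (Fin 3) (Fin 3) K) / u)) = Valued.v (ϖ ^ (2 * N + 1)))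
    (hn : Valued.v (u ^ 2 - (Matrix.trace (((γ : ↥(unitaryGroupOfForm σ ((StdForm.antidiagonal 3).over K))) : GL (Fin 3) K) : Matrix (Fin 3) (Fin 3) K) - u) * u +
      Matrix.det (((γ : ↥(unitaryGroupOfForm σ ((StdForm.antidiagonal 3).over K))) : GL (Fin 3) K) : Matrix (Fin 3) (Fin 3) K) / u) = Valued.v (ϖ ^ n))
    (hn2 : 2 ≤ n) (hN1 : 1 ≤ N) :
    σ u * u = 1 ∧ Valued.v u = 1 ∧
      ∀ i, Valued.v (((((γ : ↥(unitaryGroupOfForm σ ((StdForm.antidiagonal 3).over K))) : GL (Fin 3) K) : Matrix (Fin 3) (Fin 3) K).charpoly - (X - C u) ^ 3).coeff i) < 1 := by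
  have hϖ0 : ϖ ≠ 0 := hd.ϖ_ne_zero
  have hvϖ := hd.vϖ
  have hvpow : ∀ j : ℕ, Valued.v (ϖ ^ j) = WithZero.exp (-(j : ℤ)) := fun j => by
    rw [map_pow, hvϖ, ← WithZero.exp_nsmul, nsmul_eq_mul, mul_neg, mul_one]
  obtain ⟨-, hvϖ1, -, -, -, -⟩ := shift_parameter_facts hvϖ
  have hmat : ∀ a b : ↥(unitaryGroupOfForm σ ((StdForm.antidiagonal 3).over K)), (((a * b : ↥(unitaryGroupOfForm σ ((StdForm.antidiagonal 3).over K))) : GL (Fin 3) K) :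
      Matrix (Fin 3) (Fin 3) K) = ((a : GL (Fin 3) K) : Matrix (Fin 3) (Fin 3) K) * ((b : GL (Fin 3) K) : Matrix (Fin 3) (Fin 3) K) := fun a b => by
    rw [Subgroup.coe_mul, Units.val_mul]
  -- (d3) the literal frame
  obtain ⟨m, hm⟩ : ∃ m : ℤ, Valued.v ((Matrix.trace (((γ : ↥(unitaryGroupOfForm σ ((StdForm.antidiagonal 3).over K))) : GL (Fin 3) K) : Matrix (Fin 3) (Fin 3) K) - u) ^ 2 -
      4 * (Matrix.det (((γ : ↥(unitaryGroupOfForm σ ((StdForm.antidiagonal 3).over K))) : GL (Fin 3) K) : Matrix (Fin 3) (Fin 3) K) / u)) = WithZero.exp (2 * m + 1) :=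
    ⟨-(N : ℤ) - 1, by rw [hN, hvpow]; congr 1; push_cast; ring⟩
  obtain ⟨g, A, C, ρ, hlit, hC0, hvρ, -, hσu, htr, hdet⟩ := exists_conj_coe_eq_ramifiedTorus σ rfl hd hσO ha₀ hγx hx hm
  have hu0 : u ≠ 0 := fun h0 => by rw [h0, mul_zero] at hσu; exact zero_ne_one hσu
  have hvu : Valued.v u = 1 := by
    -- `|u|² = 1` in `ℤᵐ⁰` (norm-one scalar, `σ` isometric)
    have h := congrArg Valued.v hσu
    rw [map_mul, hd.vσ, map_one] at h
    have hvu0 : Valued.v u ≠ 0 := fun h0 => by rw [h0, mul_zero] at h; exact zero_ne_one h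
    rw [← WithZero.exp_log hvu0, ← WithZero.exp_add, ← WithZero.exp_zero, WithZero.exp_inj] at h
    rw [← WithZero.exp_log hvu0, ← WithZero.exp_zero]
    congr 1; omega
  refine ⟨hσu, hvu, fun i => ?_⟩
  -- the exponents in the frame: `|C| = |ϖ^N|`, `|(u − A)² − C²ρ| = |ϖ^n|`, whence `|A − u|, |C|, |Cρ| ≤ |ϖ|`
  obtain ⟨hvdisc, -⟩ := v_disc_and_v_eval_of_ramifiedTorus σ hd hu0 hvρ htr hdet
  have hvC : Valued.v C = Valued.v (ϖ ^ N) := v_eq_of_mul_sq_eq hd.vϖ ((Valuation.ne_zero_iff _).2 hC0) (by rw [← hvdisc, hN])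
  have hχ : Valued.v ((u - A) ^ 2 - C ^ 2 * ρ) = Valued.v (ϖ ^ n) := by
    have e : u ^ 2 - (Matrix.trace (((γ : ↥(unitaryGroupOfForm σ ((StdForm.antidiagonal 3).over K))) : GL (Fin 3) K) : Matrix (Fin 3) (Fin 3) K) - u) * u +
        Matrix.det (((γ : ↥(unitaryGroupOfForm σ ((StdForm.antidiagonal 3).over K))) : GL (Fin 3) K) : Matrix (Fin 3) (Fin 3) K) / u = (u - A) ^ 2 - C ^ 2 * ρ := by
      rw [htr, hdet]; field_simp; ring
    rw [← e]; exact hn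
  have hCρ : Valued.v (C ^ 2 * ρ) = Valued.v (ϖ ^ (2 * N + 1)) := by
    rw [map_mul, map_pow, hvC, hvρ, hvpow, hvϖ, hvpow, ← WithZero.exp_nsmul, ← WithZero.exp_add]; congr 1; push_cast; ring
  have hAu : Valued.v (A - u) ≤ Valued.v ϖ := by
    rw [Valuation.map_sub_swap]
    refine v_le_of_sq_le_sq hvϖ ?_
    have h1 : Valued.v ((u - A) ^ 2) ≤ max (Valued.v ((u - A) ^ 2 - C ^ 2 * ρ)) (Valued.v (C ^ 2 * ρ)) := by
      have e : (u - A) ^ 2 = ((u - A) ^ 2 - C ^ 2 * ρ) + C ^ 2 * ρ := by ring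
      rw [e]; exact Valuation.map_add _ _ _ |>.trans (by rw [← e])
    rw [map_pow] at h1
    refine h1.trans (max_le ?_ ?_)
    · rw [hχ, hvpow, hvϖ, ← WithZero.exp_nsmul, WithZero.exp_le_exp]; simp only [nsmul_eq_mul]; push_cast; omega
    · rw [hCρ, hvpow, hvϖ, ← WithZero.exp_nsmul, WithZero.exp_le_exp]; simp only [nsmul_eq_mul]; push_cast; omega
  have hCle : Valued.v C ≤ Valued.v ϖ := by rw [hvC, hvpow, hvϖ, WithZero.exp_le_exp]; omega
  have hCρle : Valued.v (C * ρ) ≤ Valued.v ϖ := by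
    rw [map_mul, hvρ]
    calc Valued.v C * Valued.v ϖ ≤ 1 * Valued.v ϖ := mul_le_mul' (hCle.trans hvϖ1.le) le_rfl
      _ = Valued.v ϖ := one_mul _
  -- `χ_γ = χ_t`, `t = g⁻¹γg` the literal
  have hχγ : ((((γ : ↥(unitaryGroupOfForm σ ((StdForm.antidiagonal 3).over K))) : GL (Fin 3) K) : Matrix (Fin 3) (Fin 3) K)).charpoly = (!![A, 0, C * ρ; 0, u, 0; C, 0, A] : Matrix (Fin 3) (Fin 3) K).charpoly := by
    rw [← hlit, hmat, hmat, Subgroup.coe_inv, Matrix.coe_units_inv, Matrix.charpoly_units_conj']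
  -- `χ_{u·1} = (X − u)³`
  have hχu : ((u • (1 : Matrix (Fin 3) (Fin 3) K))).charpoly = (X - Polynomial.C u) ^ 3 := by
    rw [Matrix.smul_one_eq_diagonal, Matrix.charpoly_diagonal, Finset.prod_const, Finset.card_univ, Fintype.card_fin]
  -- `t ≡ u·1 (mod ϖ)` entrywise; ★ the congruence token
  have hB : IsIntMatrix (u • (1 : Matrix (Fin 3) (Fin 3) K)) := by
    intro i j
    rw [Matrix.smul_apply, Matrix.one_apply, smul_eq_mul]
    split_ifs
    · rw [mul_one, hvu]
    · rw [mul_zero, map_zero]; exact zero_le_one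
  have hvϖinv : ∀ {z : ℤᵐ⁰}, z ≤ Valued.v ϖ → (Valued.v ϖ)⁻¹ * z ≤ 1 := fun {z} hz => by
    calc (Valued.v ϖ)⁻¹ * z ≤ (Valued.v ϖ)⁻¹ * Valued.v ϖ := by gcongr
      _ = 1 := inv_mul_cancel₀ ((Valuation.ne_zero_iff _).2 hϖ0)
  have hCρle' : Valued.v C * Valued.v ρ ≤ Valued.v ϖ := by rw [← map_mul]; exact hCρle
  have hdiff : (!![A, 0, C * ρ; 0, u, 0; C, 0, A] : Matrix (Fin 3) (Fin 3) K) - u • (1 : Matrix (Fin 3) (Fin 3) K) = !![A - u, 0, C * ρ; 0, 0, 0; C, 0, A - u] := by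
    ext i j; fin_cases i <;> fin_cases j <;> simp
  have hAB : IsIntMatrix (ϖ⁻¹ • ((!![A, 0, C * ρ; 0, u, 0; C, 0, A] : Matrix (Fin 3) (Fin 3) K) - u • (1 : Matrix (Fin 3) (Fin 3) K))) := by
    rw [hdiff]
    intro i j
    fin_cases i <;> fin_cases j <;> simp <;>
      first | exact hvϖinv hAu | exact hvϖinv hCρle' | exact hvϖinv hCle
  have key := v_inv_mul_charpoly_coeff_sub_le_one hB hvϖ1.le hAB i
  rw [Polynomial.coeff_sub, hχγ, ← hχu]
  have e : (!![A, 0, C * ρ; 0, u, 0; C, 0, A] : Matrix (Fin 3) (Fin 3) K).charpoly.coeff i - (u • (1 : Matrix (Fin 3) (Fin 3) K)).charpoly.coeff i =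
      ϖ * (ϖ⁻¹ * ((!![A, 0, C * ρ; 0, u, 0; C, 0, A] : Matrix (Fin 3) (Fin 3) K).charpoly.coeff i - (u • (1 : Matrix (Fin 3) (Fin 3) K)).charpoly.coeff i)) := by
    rw [← mul_assoc, mul_inv_cancel₀ hϖ0, one_mul]
  rw [e, map_mul]
  calc Valued.v ϖ * _ ≤ Valued.v ϖ * 1 := by gcongr
    _ < 1 := by rw [mul_one]; exact hvϖ1

end Shift

end Summit.HodgeConjecture.HodgeConjecture.R90.S6

end
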